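import Mathlib.Algebra.Order.BigOperators.Group.Finset
import Mathlib.Algebra.BigOperators.Ring.Finset
import Mathlib.Algebra.Order.Ring.Abs
import Mathlib.Data.Real.Basic
import Mathlib.Data.Finset.Piecewise
import Mathlib.Logic.Function.DependsOn
import Mathlib.Tactic.Linarith
import Mathlib.Tactic.Ring
import Mathlib.Analysis.SpecificLimits.Basic
import HarnessLib

/-!
# Dobrushin's comparison ("dusting") argument, abstract form

The combinatorial core of Dobrushin's uniqueness theorem and of the comparison / decay estimates
derived from it (Dobrushin 1968; Friedli–Velenik 2017, §6.5.2, Thm. 6.31 with Lemma 6.32,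
Prop. 6.33 and the "dusting lemma" 6.34; Georgii 2011, Ch. 8, Thm. 8.7 and the comparison
Thm. 8.20), isolated from all measure theory.

**Setting** (`Dobrushin.DustingData`). Configurations are `V → S`; `P f Δ` says that the real
observable `f` is admissible with dependence set `Δ` (it then depends only on the coordinates in
`Δ`); `T x` is the single-site averaging operator at `x` (in applications `f ↦ γ_{x} f`, the
expectation under the one-vertex kernel of a specification); `C x y ≥ 0`, supported in `y ∈ nbr x`,
bounds the influence of the spin at `y` on the kernel at `x`; `W` is the set of sites at which the
kernels may be used. The one analytic input is the **dusting estimate** (Friedli–Velenik 2017,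
Lemma 6.34): if `δ` bounds the oscillations of `f` (`Dobrushin.IsOscBound f δ`:
`|f σ - f τ| ≤ δ y` whenever `σ = τ` off `y`), then `T x f` has oscillation `0` at `x` and at most
`δ y + C x y δ x` at `y ≠ x`.

**States** (`Dobrushin.DustingData.IsInvariantState E`): a functional `E` on admissible
observables which is monotone-normalised (`inf f ≤ E f ≤ sup f`) and invariant, `E (T x f) = E f`
for `x ∈ W` (in applications: two Gibbs measures, `W = V`; or two finite-volume Gibbs
distributions, `W` = the smaller volume; or a Gibbs measure and its tilt by a local density, `W` =
the complement of the support of the density).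

**Conclusion** (`Dobrushin.DustingData.abs_sub_le_sum_pow`): if the row sums `∑_y C x y` are `≤ c ≤ 1` on `W` and
`ℓ : V → ℕ` vanishes off `W` and increases by at most `1` along the support of `C`, then for two
invariant states and every admissible `f` with oscillation bound `δ` vanishing off its dependence
set `Δ`, `|E₁ f - E₂ f| ≤ ∑_{y ∈ Δ} c ^ min n (ℓ y) · δ y` for every `n` — i.e. the influence of the
"boundary" `V ∖ W` on the difference of the two states decays geometrically in the `C`-distance
from it, and for `W = V` the two states agree on admissible observables (`abs_sub_le_pow_mul_sum`,
Friedli–Velenik 2017, Thm. 6.31: `|μ(f) - ν(f)| ≤ c^n Δ(f)`).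

The proof is Friedli–Velenik's (pp. 288–290): the vector `1` is an *estimate*
(`|E₁ f - E₂ f| ≤ ∑ a_y δ_y(f)`, Lemma 6.32 via the interpolation bound
`|f σ - f τ| ≤ ∑_{y ∈ Δ} δ y`, eq. (6.39)); applying an estimate to `T x f` and dusting improves
its `x`-component to the row `∑_y C x y a_y` (proof of Prop. 6.33); sweeping over the sites of `Δ`
gives the simultaneous improvement `Φ a`, and `Φ^n 1 ≤ c^{min(n, ℓ)}` by induction.

## References

* R. L. Dobrushin, *The description of a random field by means of conditional probabilities and
  conditions of its regularity*, Theory Probab. Appl. 13 (1968) 197–224.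
* S. Friedli, Y. Velenik, *Statistical Mechanics of Lattice Systems* (CUP 2017), §6.5.2,
  Thm. 6.31, Lemma 6.32, Prop. 6.33, Lemma 6.34 (pp. 288–290).
* H.-O. Georgii, *Gibbs Measures and Phase Transitions*, 2nd ed. (de Gruyter 2011), Ch. 8,
  Thm. 8.7, Thm. 8.20, Remark 8.26.
-/

open Finset Function

namespace Literature.Probability.LatticeModels

namespace Dobrushin

variable {V S : Type*}

/-! ### Oscillation bounds -/

/-- `δ` bounds the single-site oscillations of `f`: `δ ≥ 0` and `|f σ - f τ| ≤ δ y` whenever `σ` and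
`τ` agree off `y` (so `δ y ≥ δ_y(f)`, the oscillation of Friedli–Velenik 2017, eq. (6.38)).
[cite: FriedliVelenik2017, eq. (6.38)] -/
structure IsOscBound (f : (V → S) → ℝ) (δ : V → ℝ) : Prop where
  /-- oscillation bounds are nonnegative -/
  nonneg : ∀ y, 0 ≤ δ y
  /-- the oscillation at `y` is at most `δ y` -/
  le : ∀ (y : V) (σ τ : V → S), (∀ z, z ≠ y → σ z = τ z) → |f σ - f τ| ≤ δ y

namespace IsOscBound

/-- A function bounded by `M ≥ 0` has all oscillations `≤ 2M` (Friedli–Velenik 2017, after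
eq. (6.40): local bounded functions have finite total oscillation). [cite: FriedliVelenik2017, eq. (6.40)] -/
theorem of_abs_le {f : (V → S) → ℝ} {M : ℝ} (hM0 : 0 ≤ M) (hM : ∀ σ, |f σ| ≤ M) :
    IsOscBound f fun _ => 2 * M where
  nonneg _ := by linarith
  le y σ τ _ := by
    calc |f σ - f τ| ≤ |f σ| + |f τ| := abs_sub _ _
      _ ≤ M + M := add_le_add (hM σ) (hM τ)
      _ = 2 * M := by ring

/-- If `f` depends only on the coordinates in `Δ`, an oscillation bound may be cut down to `Δ`
(the oscillation of `f` at a site it does not depend on is `0`) (Friedli–Velenik 2017, eq. (6.39)).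
[cite: FriedliVelenik2017, eq. (6.39)] -/
theorem restrict [DecidableEq V] {f : (V → S) → ℝ} {δ : V → ℝ} (h : IsOscBound f δ)
    {Δ : Finset V} (hdep : DependsOn f (↑Δ : Set V)) :
    IsOscBound f fun y => if y ∈ Δ then δ y else 0 where
  nonneg y := by
    split_ifs
    · exact h.nonneg y
    · exact le_rfl
  le y σ τ hστ := by
    split_ifs with hy
    · exact h.le y σ τ hστ
    · rw [hdep (fun i hi => hστ i (fun h' => hy (h' ▸ Finset.mem_coe.1 hi))), sub_self, abs_zero]

/-- Weakening an oscillation bound pointwise. [folklore] -/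
theorem mono {f : (V → S) → ℝ} {δ δ' : V → ℝ} (h : IsOscBound f δ) (hle : ∀ y, δ y ≤ δ' y) :
    IsOscBound f δ' where
  nonneg y := (h.nonneg y).trans (hle y)
  le y σ τ hστ := (h.le y σ τ hστ).trans (hle y)

end IsOscBound

/-- **Interpolation bound** (Friedli–Velenik 2017, eq. (6.39)): if `f` depends only on the
coordinates in the finite set `Δ` and `δ` bounds its oscillations, then `|f σ - f τ| ≤ ∑_{y ∈ Δ} δ y`
for all `σ, τ` (change the coordinates of `σ` in `Δ` into those of `τ` one at a time).
[cite: FriedliVelenik2017, eq. (6.39)] -/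
theorem abs_sub_le_sum_of_dependsOn [DecidableEq V] {f : (V → S) → ℝ} {Δ : Finset V} {δ : V → ℝ}
    (hdep : DependsOn f (↑Δ : Set V)) (hδ : IsOscBound f δ) (σ τ : V → S) :
    |f σ - f τ| ≤ ∑ y ∈ Δ, δ y := by
  suffices h : ∀ s : Finset V, |f σ - f (s.piecewise τ σ)| ≤ ∑ y ∈ s, δ y by
    have hΔ : f (Δ.piecewise τ σ) = f τ :=
      hdep fun i hi => Finset.piecewise_eq_of_mem _ _ _ (Finset.mem_coe.1 hi)
    simpa [hΔ] using h Δ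
  intro s
  induction s using Finset.induction_on with
  | empty => simp
  | insert y s hy ih =>
    rw [Finset.sum_insert hy]
    have hstep : |f (s.piecewise τ σ) - f ((insert y s).piecewise τ σ)| ≤ δ y := by
      refine hδ.le y _ _ fun z hz => ?_
      rw [Finset.piecewise_insert_of_ne _ _ _ hz]
    calc |f σ - f ((insert y s).piecewise τ σ)|
        ≤ |f σ - f (s.piecewise τ σ)| + |f (s.piecewise τ σ) - f ((insert y s).piecewise τ σ)| :=
          abs_sub_le _ _ _
      _ ≤ (∑ y ∈ s, δ y) + δ y := add_le_add ih hstep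
      _ = δ y + ∑ y ∈ s, δ y := add_comm _ _

/-! ### The abstract setting -/

variable (V S) in
/-- The data of Dobrushin's comparison argument (Friedli–Velenik 2017, §6.5.2; Georgii 2011,
§8.1): admissible observables `P f Δ` (with dependence set `Δ`), single-site averaging operators
`T x`, influence coefficients `C x y ≥ 0` supported in `y ∈ nbr x`, the set `W` of usable sites, and
the **dusting estimate** (Friedli–Velenik 2017, Lemma 6.34): `δ_x(T_x f) = 0` and
`δ_y(T_x f) ≤ δ_y(f) + C x y δ_x(f)` for `y ≠ x`. [cite: FriedliVelenik2017, Lemma 6.34] -/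
structure DustingData [DecidableEq V] where
  /-- admissible observables together with a dependence set -/
  P : ((V → S) → ℝ) → Finset V → Prop
  /-- the single-site averaging operator at `x` -/
  T : V → ((V → S) → ℝ) → ((V → S) → ℝ)
  /-- the influence coefficient of the spin at `y` on the kernel at `x` -/
  C : V → V → ℝ
  /-- a finite set of sites supporting `C x ·` -/
  nbr : V → Finset V
  /-- the sites at which the averaging operators may be used -/
  W : Set V
  /-- an admissible observable depends only on its dependence set -/
  dependsOn_of : ∀ {f : (V → S) → ℝ} {Δ : Finset V}, P f Δ → DependsOn f (↑Δ : Set V)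
  /-- admissible observables are stable under averaging at usable sites -/
  exists_of : ∀ {f : (V → S) → ℝ} {Δ : Finset V} (x : V), x ∈ W → P f Δ → ∃ Δ', P (T x f) Δ'
  /-- influence coefficients are nonnegative -/
  C_nonneg : ∀ x y, 0 ≤ C x y
  /-- and vanish off `nbr x` -/
  C_eq_zero : ∀ x y, y ∉ nbr x → C x y = 0
  /-- the dusting estimate (Friedli–Velenik 2017, Lemma 6.34) -/
  dust : ∀ {f : (V → S) → ℝ} {Δ : Finset V} {δ : V → ℝ} (x : V), x ∈ W → P f Δ →
    IsOscBound f δ → IsOscBound (T x f) fun y => if y = x then 0 else δ y + C x y * δ x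

namespace DustingData

variable [DecidableEq V] (D : DustingData V S)

/-- The row action of the influence matrix on a vector: `(C a)_x = ∑_{y ∈ nbr x} C x y · a y`
(Friedli–Velenik 2017, proof of Prop. 6.33). [cite: FriedliVelenik2017, Prop. 6.33] -/
def rowC (a : V → ℝ) (x : V) : ℝ := ∑ y ∈ D.nbr x, D.C x y * a y

/-- `rowC` is monotone in the vector (the coefficients are nonnegative). [folklore] -/
theorem rowC_mono {a b : V → ℝ} (h : ∀ y, a y ≤ b y) (x : V) : D.rowC a x ≤ D.rowC b x :=
  Finset.sum_le_sum fun y _ => mul_le_mul_of_nonneg_left (h y) (D.C_nonneg x y)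

/-- `rowC a ≥ 0` for `a ≥ 0`. [folklore] -/
theorem rowC_nonneg {a : V → ℝ} (h : ∀ y, 0 ≤ a y) (x : V) : 0 ≤ D.rowC a x :=
  Finset.sum_nonneg fun y _ => mul_nonneg (D.C_nonneg x y) (h y)

/-- An **invariant state** for the dusting data: a functional on admissible observables with
`inf f ≤ E f ≤ sup f` and `E (T x f) = E f` for usable `x` (e.g. the expectation under a Gibbs
measure, by the DLR equations `μ γ_x = μ`; Friedli–Velenik 2017, proof of Thm. 6.31).
[cite: FriedliVelenik2017, Thm. 6.31] -/
structure IsInvariantState (E : ((V → S) → ℝ) → ℝ) : Prop where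
  /-- `E f ≤ sup f` -/
  le_of_forall_le : ∀ {f : (V → S) → ℝ} {Δ : Finset V} {M : ℝ}, D.P f Δ → (∀ σ, f σ ≤ M) → E f ≤ M
  /-- `inf f ≤ E f` -/
  ge_of_forall_ge : ∀ {f : (V → S) → ℝ} {Δ : Finset V} {m : ℝ}, D.P f Δ → (∀ σ, m ≤ f σ) → m ≤ E f
  /-- invariance under the averaging operators at usable sites -/
  apply_T : ∀ {f : (V → S) → ℝ} {Δ : Finset V} (x : V), x ∈ D.W → D.P f Δ → E (D.T x f) = E f

/-- `a` is an **estimate** for the pair of states `E₁, E₂`: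
`|E₁ f - E₂ f| ≤ ∑_{y ∈ Δ} a y · δ y` for every admissible `f` with dependence set `Δ` and every
oscillation bound `δ` of `f` vanishing off `Δ` (Friedli–Velenik 2017, eq. (6.42)/(6.45)).
[cite: FriedliVelenik2017, eq. (6.42)] -/
def IsEstimate (E₁ E₂ : ((V → S) → ℝ) → ℝ) (a : V → ℝ) : Prop :=
  ∀ ⦃f : (V → S) → ℝ⦄ ⦃Δ : Finset V⦄ ⦃δ : V → ℝ⦄, D.P f Δ → IsOscBound f δ → (∀ y ∉ Δ, δ y = 0) →
    |E₁ f - E₂ f| ≤ ∑ y ∈ Δ, a y * δ y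

variable {D} {E₁ E₂ : ((V → S) → ℝ) → ℝ}

/-- **The constant vector `1` is an estimate** (Friedli–Velenik 2017, Lemma 6.32 and eq. (6.41):
`|μ(f) - ν(f)| ≤ sup f - inf f ≤ Δ(f)`). [cite: FriedliVelenik2017, Lemma 6.32] -/
theorem isEstimate_one (h₁ : D.IsInvariantState E₁) (h₂ : D.IsInvariantState E₂) :
    D.IsEstimate E₁ E₂ fun _ => 1 := by
  intro f Δ δ hf hδ _
  have hB : ∀ σ τ, f σ ≤ f τ + ∑ y ∈ Δ, δ y := fun σ τ => by
    have h := abs_sub_le_sum_of_dependsOn (D.dependsOn_of hf) hδ σ τ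
    linarith [(abs_le.1 h).2]
  have h12 : E₁ f ≤ E₂ f + ∑ y ∈ Δ, δ y := h₁.le_of_forall_le hf fun σ => by
    have : f σ - ∑ y ∈ Δ, δ y ≤ E₂ f := h₂.ge_of_forall_ge hf fun τ => by linarith [hB σ τ]
    linarith
  have h21 : E₂ f ≤ E₁ f + ∑ y ∈ Δ, δ y := h₂.le_of_forall_le hf fun σ => by
    have : f σ - ∑ y ∈ Δ, δ y ≤ E₁ f := h₁.ge_of_forall_ge hf fun τ => by linarith [hB σ τ]
    linarith
  simp only [one_mul]
  rw [abs_le]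
  constructor <;> linarith

/-- Estimates may be weakened pointwise (oscillation bounds are nonnegative). [folklore] -/
theorem IsEstimate.mono {a b : V → ℝ} (ha : D.IsEstimate E₁ E₂ a) (hab : ∀ y, a y ≤ b y) :
    D.IsEstimate E₁ E₂ b := fun _ _ _ hf hδ hδ0 =>
  (ha hf hδ hδ0).trans (Finset.sum_le_sum fun y _ => mul_le_mul_of_nonneg_right (hab y) (hδ.nonneg y))

/-- The bookkeeping inequality behind the dusting step: with `a, δ ≥ 0`, `δ = 0` off `Δ`, and
`C x · ≥ 0` supported in `nbr x`,
`∑_{y ∈ Δ'} a y · 𝟙[y ∈ Δ'] (𝟙[y ≠ x] (δ y + C x y δ x)) ≤ ∑_{y ∈ Δ} (a[x ↦ (C a)_x]) y · δ y`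
(Friedli–Velenik 2017, proof of Prop. 6.33). [cite: FriedliVelenik2017, Prop. 6.33] -/
theorem sum_dust_le {a δ : V → ℝ} {C : V → V → ℝ} {nbr : V → Finset V} (x : V)
    (Δ Δ' : Finset V) (ha0 : ∀ y, 0 ≤ a y) (hδn : ∀ y, 0 ≤ δ y) (hδ0 : ∀ y ∉ Δ, δ y = 0)
    (hC0 : ∀ y, 0 ≤ C x y) (hCz : ∀ y ∉ nbr x, C x y = 0) :
    ∑ y ∈ Δ', a y * (if y ∈ Δ' then (if y = x then 0 else δ y + C x y * δ x) else 0) ≤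
      ∑ y ∈ Δ, Function.update a x (∑ z ∈ nbr x, C x z * a z) y * δ y := by
  set r := ∑ z ∈ nbr x, C x z * a z with hr
  have h1 : ∑ y ∈ Δ', a y * (if y ∈ Δ' then (if y = x then 0 else δ y + C x y * δ x) else 0) =
      ∑ y ∈ Δ'.erase x, (a y * δ y + δ x * (C x y * a y)) := by
    rw [← Finset.sum_erase Δ' (a := x) (by simp)]
    refine Finset.sum_congr rfl fun y hy => ?_
    rw [Finset.mem_erase] at hy
    rw [if_pos hy.2, if_neg hy.1]
    ring
  have h2 : ∑ y ∈ Δ'.erase x, a y * δ y ≤ ∑ y ∈ Δ.erase x, a y * δ y := by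
    rw [← Finset.sum_filter_of_ne (p := (· ∈ Δ)) (fun y _ hne => ?_)]
    · apply Finset.sum_le_sum_of_subset_of_nonneg
      · intro y hy
        simp only [Finset.mem_filter, Finset.mem_erase] at hy ⊢
        exact ⟨hy.1.1, hy.2⟩
      · intro y _ _
        exact mul_nonneg (ha0 y) (hδn y)
    · by_contra hyΔ
      exact hne (by rw [hδ0 y hyΔ, mul_zero])
  have h3 : ∑ y ∈ Δ'.erase x, C x y * a y ≤ r := by
    rw [hr, ← Finset.sum_filter_of_ne (s := Δ'.erase x) (p := (· ∈ nbr x)) (fun y _ hne => ?_)]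
    · apply Finset.sum_le_sum_of_subset_of_nonneg
      · intro y hy
        simp only [Finset.mem_filter] at hy
        exact hy.2
      · intro y _ _
        exact mul_nonneg (hC0 y) (ha0 y)
    · by_contra hyn
      exact hne (by rw [hCz y hyn, zero_mul])
  have hupd : ∀ y ∈ Δ.erase x, Function.update a x r y * δ y = a y * δ y := fun y hy => by
    rw [Function.update_of_ne (Finset.mem_erase.1 hy).1]
  have h4 : ∑ y ∈ Δ.erase x, a y * δ y + δ x * r ≤ ∑ y ∈ Δ, Function.update a x r y * δ y := by
    by_cases hx : x ∈ Δ
    · rw [← Finset.add_sum_erase Δ _ hx, Function.update_self, Finset.sum_congr rfl hupd]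
      linarith
    · rw [hδ0 x hx, zero_mul, add_zero, ← Finset.sum_congr rfl hupd, Finset.erase_eq_of_notMem hx]
  calc ∑ y ∈ Δ', a y * (if y ∈ Δ' then (if y = x then 0 else δ y + C x y * δ x) else 0)
      = ∑ y ∈ Δ'.erase x, (a y * δ y + δ x * (C x y * a y)) := h1
    _ = ∑ y ∈ Δ'.erase x, a y * δ y + δ x * ∑ y ∈ Δ'.erase x, C x y * a y := by
        rw [Finset.sum_add_distrib, Finset.mul_sum]
    _ ≤ ∑ y ∈ Δ.erase x, a y * δ y + δ x * r :=
        add_le_add h2 (mul_le_mul_of_nonneg_left h3 (hδn x))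
    _ ≤ _ := h4

/-- **Dusting step** (Friedli–Velenik 2017, proof of Prop. 6.33): if `a ≥ 0` is an estimate and
`x` is usable, then replacing `a x` by the row `(C a)_x` gives an estimate — apply the estimate to
`T x f` (same expectations) and the dusting lemma. [cite: FriedliVelenik2017, Prop. 6.33] -/
theorem IsEstimate.update (h₁ : D.IsInvariantState E₁) (h₂ : D.IsInvariantState E₂) {a : V → ℝ}
    (ha : D.IsEstimate E₁ E₂ a) (ha0 : ∀ y, 0 ≤ a y) {x : V} (hx : x ∈ D.W) :
    D.IsEstimate E₁ E₂ (Function.update a x (D.rowC a x)) := by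
  intro f Δ δ hf hδ hδ0
  obtain ⟨Δ', hf'⟩ := D.exists_of x hx hf
  have hδ' := (D.dust x hx hf hδ).restrict (D.dependsOn_of hf')
  have key := ha hf' hδ' fun y hy => if_neg hy
  rw [h₁.apply_T x hx hf, h₂.apply_T x hx hf] at key
  exact key.trans (sum_dust_le x Δ Δ' ha0 hδ.nonneg hδ0 (D.C_nonneg x) (D.C_eq_zero x))

/-- Dusting step, monotone form: replacing `a x` by `min (a x) ((C a)_x)` gives an estimate.
[cite: FriedliVelenik2017, Prop. 6.33] -/
theorem IsEstimate.update_min (h₁ : D.IsInvariantState E₁) (h₂ : D.IsInvariantState E₂)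
    {a : V → ℝ} (ha : D.IsEstimate E₁ E₂ a) (ha0 : ∀ y, 0 ≤ a y) {x : V} (hx : x ∈ D.W) :
    D.IsEstimate E₁ E₂ (Function.update a x (min (a x) (D.rowC a x))) := by
  rcases le_total (a x) (D.rowC a x) with h | h
  · rw [min_eq_left h, Function.update_eq_self]
    exact ha
  · rw [min_eq_right h]
    exact ha.update h₁ h₂ ha0 hx

/-- The **simultaneous improvement** map: `Φ a = (C a)` on `W` and `a` off `W`
(Friedli–Velenik 2017, Prop. 6.33: an estimate `a` yields the estimate `c(π) a`; here in the
vector form needed when `W ≠ V`). [cite: FriedliVelenik2017, Prop. 6.33] -/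
noncomputable def phi (a : V → ℝ) : V → ℝ :=
  open scoped Classical in fun y => if y ∈ D.W then D.rowC a y else a y

/-- `Φ a y = (C a)_y` for usable `y`. [folklore] -/
theorem phi_apply_of_mem {a : V → ℝ} {y : V} (hy : y ∈ D.W) : D.phi a y = D.rowC a y := by
  simp [phi, hy]

/-- `Φ a y = a y` off `W`. [folklore] -/
theorem phi_apply_of_not_mem {a : V → ℝ} {y : V} (hy : y ∉ D.W) : D.phi a y = a y := by
  simp [phi, hy]

/-- `Φ` preserves nonnegativity. [folklore] -/
theorem phi_nonneg {a : V → ℝ} (h : ∀ y, 0 ≤ a y) (y : V) : 0 ≤ D.phi a y := by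
  by_cases hy : y ∈ D.W
  · rw [D.phi_apply_of_mem hy]; exact D.rowC_nonneg h y
  · rw [D.phi_apply_of_not_mem hy]; exact h y

/-- **Proposition 6.33 of Friedli–Velenik (vector form)**: if `a ≥ 0` is an estimate then so is
`Φ a` — sweep the dusting step over the finitely many sites of the dependence set, keeping the
intermediate vectors below `a`. [cite: FriedliVelenik2017, Prop. 6.33] -/
theorem IsEstimate.phi (h₁ : D.IsInvariantState E₁) (h₂ : D.IsInvariantState E₂) {a : V → ℝ}
    (ha : D.IsEstimate E₁ E₂ a) (ha0 : ∀ y, 0 ≤ a y) : D.IsEstimate E₁ E₂ (D.phi a) := by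
  intro f Δ δ hf hδ hδ0
  -- sweep over the sites of `Δ`
  have sweep : ∀ s : Finset V, ∃ b : V → ℝ, D.IsEstimate E₁ E₂ b ∧ (∀ y, 0 ≤ b y) ∧
      (∀ y, b y ≤ a y) ∧ ∀ y ∈ s, y ∈ D.W → b y ≤ D.rowC a y := by
    intro s
    induction s using Finset.induction_on with
    | empty => exact ⟨a, ha, ha0, fun _ => le_rfl, fun _ h => (Finset.notMem_empty _ h).elim⟩
    | insert x s _ ih =>
      obtain ⟨b, hb, hb0, hba, hbs⟩ := ih
      by_cases hx : x ∈ D.W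
      · refine ⟨Function.update b x (min (b x) (D.rowC b x)), hb.update_min h₁ h₂ hb0 hx,
          fun y => ?_, fun y => ?_, fun y hy hyW => ?_⟩
        · rcases eq_or_ne y x with rfl | hne
          · rw [Function.update_self]; exact le_min (hb0 _) (D.rowC_nonneg hb0 _)
          · rw [Function.update_of_ne hne]; exact hb0 y
        · rcases eq_or_ne y x with rfl | hne
          · rw [Function.update_self]; exact (min_le_left _ _).trans (hba _)
          · rw [Function.update_of_ne hne]; exact hba y
        · rcases eq_or_ne y x with rfl | hne
          · rw [Function.update_self]
            exact (min_le_right _ _).trans (D.rowC_mono hba _)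
          · rw [Function.update_of_ne hne]
            exact hbs y ((Finset.mem_insert.1 hy).resolve_left hne) hyW
      · refine ⟨b, hb, hb0, hba, fun y hy hyW => ?_⟩
        rcases eq_or_ne y x with rfl | hne
        · exact (hx hyW).elim
        · exact hbs y ((Finset.mem_insert.1 hy).resolve_left hne) hyW
  obtain ⟨b, hb, -, hba, hbs⟩ := sweep Δ
  refine (hb hf hδ hδ0).trans (Finset.sum_le_sum fun y hy => ?_)
  refine mul_le_mul_of_nonneg_right ?_ (hδ.nonneg y)
  by_cases hyW : y ∈ D.W
  · rw [D.phi_apply_of_mem hyW]; exact hbs y hy hyW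
  · rw [D.phi_apply_of_not_mem hyW]; exact hba y

/-- All iterates `Φ^n 1` are nonnegative estimates (Friedli–Velenik 2017, proof of Thm. 6.31:
"we can apply Proposition 6.33 repeatedly"). [cite: FriedliVelenik2017, Thm. 6.31] -/
theorem isEstimate_iterate_phi (h₁ : D.IsInvariantState E₁) (h₂ : D.IsInvariantState E₂) (n : ℕ) :
    D.IsEstimate E₁ E₂ (D.phi^[n] fun _ => 1) ∧ ∀ y, 0 ≤ (D.phi^[n] fun _ => 1) y := by
  induction n with
  | zero => exact ⟨isEstimate_one h₁ h₂, fun _ => zero_le_one⟩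
  | succ n ih =>
    rw [Function.iterate_succ_apply']
    exact ⟨ih.1.phi h₁ h₂ ih.2, D.phi_nonneg ih.2⟩

/-- **Geometric profile of the iterates**: if the rows of `C` sum to at most `c ∈ [0, 1]` on `W`,
`ℓ = 0` off `W` and `ℓ x ≤ ℓ y + 1` for `y ∈ nbr x`, `x ∈ W`, then `(Φ^n 1)_y ≤ c ^ min n (ℓ y)`
(the boundary influence decays geometrically in the `C`-distance from `V ∖ W`; Georgii 2011,
Remark 8.26 / Thm. 8.20 for this use of the iteration). [cite: Georgii2011, Thm. 8.20] -/
theorem iterate_phi_le_pow {c : ℝ} (hc0 : 0 ≤ c) (hc1 : c ≤ 1)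
    (hrow : ∀ x ∈ D.W, ∑ y ∈ D.nbr x, D.C x y ≤ c) (ℓ : V → ℕ) (hℓW : ∀ y ∉ D.W, ℓ y = 0)
    (hℓ : ∀ x ∈ D.W, ∀ y ∈ D.nbr x, ℓ x ≤ ℓ y + 1) (n : ℕ) (y : V) :
    (D.phi^[n] fun _ => 1) y ≤ c ^ min n (ℓ y) := by
  induction n generalizing y with
  | zero => simp
  | succ n ih =>
    rw [Function.iterate_succ_apply']
    by_cases hy : y ∈ D.W
    · rw [D.phi_apply_of_mem hy, rowC]
      calc ∑ z ∈ D.nbr y, D.C y z * (D.phi^[n] fun _ => 1) z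
          ≤ ∑ z ∈ D.nbr y, D.C y z * c ^ min n (ℓ y - 1) := by
            refine Finset.sum_le_sum fun z hz => mul_le_mul_of_nonneg_left ?_ (D.C_nonneg y z)
            refine (ih z).trans (pow_le_pow_of_le_one hc0 hc1 ?_)
            have := hℓ y hy z hz
            omega
        _ = (∑ z ∈ D.nbr y, D.C y z) * c ^ min n (ℓ y - 1) := (Finset.sum_mul _ _ _).symm
        _ ≤ c * c ^ min n (ℓ y - 1) :=
            mul_le_mul_of_nonneg_right (hrow y hy) (pow_nonneg hc0 _)
        _ = c ^ (min n (ℓ y - 1) + 1) := by ring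
        _ ≤ c ^ min (n + 1) (ℓ y) := pow_le_pow_of_le_one hc0 hc1 (by omega)
    · rw [D.phi_apply_of_not_mem hy, hℓW y hy]
      refine (ih y).trans ?_
      rw [hℓW y hy]
      simp

/-- **Dobrushin's comparison estimate** (Friedli–Velenik 2017, Thm. 6.31 with Prop. 6.33;
Georgii 2011, Thm. 8.20 / Remark 8.26): for two invariant states of the dusting data, with row
sums `≤ c ≤ 1` on `W` and a profile `ℓ` vanishing off `W` and `1`-Lipschitz along the support of
`C`, every admissible `f` with dependence set `Δ` and oscillation bound `δ` vanishing off `Δ`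
satisfies `|E₁ f - E₂ f| ≤ ∑_{y ∈ Δ} c ^ min n (ℓ y) · δ y` for every `n`.
[cite: FriedliVelenik2017, Thm. 6.31 with Prop. 6.33] -/
theorem abs_sub_le_sum_pow (h₁ : D.IsInvariantState E₁) (h₂ : D.IsInvariantState E₂) {c : ℝ}
    (hc0 : 0 ≤ c) (hc1 : c ≤ 1) (hrow : ∀ x ∈ D.W, ∑ y ∈ D.nbr x, D.C x y ≤ c) (ℓ : V → ℕ)
    (hℓW : ∀ y ∉ D.W, ℓ y = 0) (hℓ : ∀ x ∈ D.W, ∀ y ∈ D.nbr x, ℓ x ≤ ℓ y + 1)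
    {f : (V → S) → ℝ} {Δ : Finset V} {δ : V → ℝ} (hf : D.P f Δ) (hδ : IsOscBound f δ)
    (hδ0 : ∀ y ∉ Δ, δ y = 0) (n : ℕ) :
    |E₁ f - E₂ f| ≤ ∑ y ∈ Δ, c ^ min n (ℓ y) * δ y := by
  obtain ⟨hest, -⟩ := isEstimate_iterate_phi h₁ h₂ n
  refine (hest hf hδ hδ0).trans (Finset.sum_le_sum fun y _ => ?_)
  exact mul_le_mul_of_nonneg_right (D.iterate_phi_le_pow hc0 hc1 hrow ℓ hℓW hℓ n y) (hδ.nonneg y)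

/-- **Dobrushin's uniqueness estimate** (Friedli–Velenik 2017, Thm. 6.31: `|μ(f) - ν(f)| ≤ c^n Δ(f)`
for all `n`, hence `μ(f) = ν(f)` when `c < 1`): if every site is usable and the row sums are
`≤ c ≤ 1`, then `|E₁ f - E₂ f| ≤ c ^ n ∑_{y ∈ Δ} δ y`. [cite: FriedliVelenik2017, Thm. 6.31] -/
theorem abs_sub_le_pow_mul_sum (h₁ : D.IsInvariantState E₁) (h₂ : D.IsInvariantState E₂) {c : ℝ}
    (hc0 : 0 ≤ c) (hc1 : c ≤ 1) (hW : ∀ x, x ∈ D.W) (hrow : ∀ x, ∑ y ∈ D.nbr x, D.C x y ≤ c)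
    {f : (V → S) → ℝ} {Δ : Finset V} {δ : V → ℝ} (hf : D.P f Δ) (hδ : IsOscBound f δ)
    (hδ0 : ∀ y ∉ Δ, δ y = 0) (n : ℕ) :
    |E₁ f - E₂ f| ≤ c ^ n * ∑ y ∈ Δ, δ y := by
  have h := D.abs_sub_le_sum_pow h₁ h₂ hc0 hc1 (fun x _ => hrow x) (fun _ => n)
    (fun y hy => (hy (hW y)).elim) (fun _ _ _ _ => Nat.le_succ n) hf hδ hδ0 n
  simpa [Finset.mul_sum] using h

/-- **Equality of invariant states** (Friedli–Velenik 2017, Thm. 6.31, conclusion): under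
Dobrushin's condition `c < 1` with all sites usable, two invariant states agree on every admissible
observable admitting an oscillation bound. [cite: FriedliVelenik2017, Thm. 6.31] -/
theorem eq_of_lt_one (h₁ : D.IsInvariantState E₁) (h₂ : D.IsInvariantState E₂) {c : ℝ}
    (hc0 : 0 ≤ c) (hc1 : c < 1) (hW : ∀ x, x ∈ D.W) (hrow : ∀ x, ∑ y ∈ D.nbr x, D.C x y ≤ c)
    {f : (V → S) → ℝ} {Δ : Finset V} {δ : V → ℝ} (hf : D.P f Δ) (hδ : IsOscBound f δ) :
    E₁ f = E₂ f := by
  have hδ' := hδ.restrict (D.dependsOn_of hf)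
  have hB : ∀ n : ℕ, |E₁ f - E₂ f| ≤ c ^ n * ∑ y ∈ Δ, (if y ∈ Δ then δ y else 0) := fun n =>
    D.abs_sub_le_pow_mul_sum h₁ h₂ hc0 hc1.le hW hrow hf hδ' (fun y hy => if_neg hy) n
  have hlim : Filter.Tendsto (fun n : ℕ => c ^ n * ∑ y ∈ Δ, (if y ∈ Δ then δ y else 0))
      Filter.atTop (nhds 0) := by
    simpa using (tendsto_pow_atTop_nhds_zero_of_lt_one hc0 hc1).mul_const _
  have h0 : |E₁ f - E₂ f| ≤ 0 :=
    ge_of_tendsto' hlim hB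
  exact sub_eq_zero.1 (abs_nonpos_iff.1 h0)

end DustingData

end Dobrushin

end Literature.Probability.LatticeModels
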